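import Literature.Computability.Complexity.StackScript
import Literature.Computability.Complexity.StackStreams
import HarnessLib

/-!
# Vectors over `ℤ/N` on stack registers: streaming modular arithmetic and negacyclic shifts

Literature / complexity toolkit, continuing `StackNumeric.lean` (the numeric procedure layer on
`EReg ⊕ β`: `base T`, procedures `nAdd`, `nSub`, `nCmp`, `nModMul`, `nToUnary`, …),
`StackScript.lean` (numeric scripts `Com.NS` verified by symbolic execution) and
`StackStreams.lean` (item reader `readItemTo`, token loop `streamLoop`, counted loop
`countLoop`) / `StackLists.lean` (list coding `encList`, `emit`, `outRev`).  It is the first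
layer of the polynomial-arithmetic programme serving the machine of Harvey's deterministic
factoring algorithm (`Cryptography/Harvey2021.lean`, `Cryptography/PQCWave0.lean`, fact
`harvey_factoring_one_fifth`): the coefficient blocks of the Schönhage–Strassen /
Cantor–Kaltofen multiplication in `(ℤ/N)[x]/(x^L + 1)` are *vectors of residues*, and every
pass of that algorithm is a stream over such vectors doing one modular operation per entry.
This file provides:

* the coding `encVec v = encList (v.map encodeNat)` of a vector `v : List ℕ` of residues
  (`encVec_cons`, `encVec_append`, `length_encVec_le`);
* the specifications `vaddMod`, `vsubMod`, `vscaleMod`, `negMod` (entrywise sum / difference /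
  scalar multiple / negation modulo `N`, with their values in `ZMod N`:
  `natCast_vaddMod_entry`, …) and `negShift N L e v` — the coefficient vector of `x^e · v(x)`
  in `(ℤ/N)[x]/(x^L+1)` for a block `v` of length `L` and `e < 2L` (rotate, negating the wrapped
  entries; `length_negShift`, `lt_of_mem_negShift`);
* the register roles `VReg` (embedded into an arbitrary outer bank `β` by `r : VReg ↪ β`),
  the entry scripts `addModS`, `subModS`, `scaleModS`, `negModS`, `moveS` with their symbolic
  executions (`binSpec_addModS`, …, in the uniform shapes `BinSpec` / `UnSpec`);
* streaming rounds abstractly: `UnRound` / `BinRound` (a program consuming one entry of `L1`,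
  resp. of `L1` and `L2`, and emitting one item onto the accumulator `O`) under a frame
  invariant (`FrameInv`), and the three loop rules **`runs_streamLoop_un`**,
  **`runs_countLoop_un`**, **`runs_streamLoop_bin`** (exact effect, cost `|v| · (c + O(1))`);
  the script rounds `vUnBody S` / `vBinBody S` are rounds (`unRound_vUnBody`,
  `binRound_vBinBody`);
* the passes: generic `vUnPass S` / `vBinPass S` (**`runs_vUnPass`**, **`runs_vBinPass`**:
  `DST := encVec (result) ++ DST`, inputs consumed, scratch clean again, cost
  `vPassCost S.cost n |v|`, linear in `|v|` times `(n+1)³` for the size bound `n ≥ |N| + 1`),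
  their instances `vAddMod`, `vSubMod`, `vScaleMod`, `vNegMod` (`runs_vAddMod`, …, cost
  `vArithCost n |v|`), and the negacyclic shift **`vNegShift`** (**`runs_vNegShift`**:
  `DST := encVec (negShift N L e v) ++ DST` within `vShiftCost n L`; a setup script computing
  the split point `shiftSplit L e` and the sign flag, a counted loop moving the first part, a
  token loop moving the rest, two pours).

Method: each round reads entries with `readItemTo`, runs a numeric script
(`Com.NS.runs_of_eq`) and `emit`s the result onto the reversed accumulator, which a pass pours
onto the destination (`reverse_outRev`); register files are compared in frame style
(`Regs.eq_of_on`).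

## References

* J. von zur Gathen, J. Gerhard, *Modern Computer Algebra*, 3rd ed., CUP 2013, §8.3 (the ring
  `R[x]/(x^n + 1)`, multiplication by powers of `x` as signed cyclic shifts; Schönhage–Strassen).
  (Not held; folklore material, fully proved here.)
* D. E. Knuth, *The Art of Computer Programming*, Vol. 2, 3rd ed., Addison–Wesley 1998, §4.3.1
  (classical modular addition and subtraction). (Not held; folklore, proved here.)
* D. Harvey, *An exponent one-fifth algorithm for deterministic integer factorisation*, Math.
  Comp. 90 (2021), §2.1–2.2 (the arithmetic model: elements of `ℤ_N` as residues in `[0, N)`,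
  polynomials as coefficient lists) [Harvey2021].
* T. Nipkow, G. Klein, *Concrete Semantics with Isabelle/HOL*, Springer 2014, §7.2 — the
  verification style of `StackPrograms.lean`.
-/

namespace Literature.Computability.Complexity

open _root_.Computability SProg

/-! ### Vectors of residues: coding -/

/-- The register coding of a vector of natural numbers: the list coding of their numerals.
[folklore] -/
def encVec (v : List ℕ) : List Bool := encList (v.map encodeNat)

/-- Coding of the empty vector. [folklore] -/
@[simp] theorem encVec_nil : encVec [] = [] := rfl

/-- Coding of a nonempty vector: the first entry's item `dbl (encodeNat a) ++ 01`, then the rest.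
[folklore] -/
theorem encVec_cons (a : ℕ) (v : List ℕ) :
    encVec (a :: v) = dbl (encodeNat a) ++ false :: true :: encVec v := by
  unfold encVec; rw [List.map_cons, Com.encList_cons_eq_dbl]

/-- A nonempty vector has a nonempty code. [folklore] -/
theorem encVec_cons_ne_nil (a : ℕ) (v : List ℕ) : encVec (a :: v) ≠ [] := by
  rw [encVec_cons]; simp

/-- `encVec` through `outRev`: the reversed accumulator of the emitted numerals. [folklore] -/
theorem reverse_outRev_map (v : List ℕ) : (Com.outRev (v.map encodeNat)).reverse = encVec v :=
  Com.reverse_outRev _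

/-- Length of the code of a vector whose entries have numerals of length `≤ m`. [folklore] -/
theorem length_encVec_le {v : List ℕ} {m : ℕ} (h : ∀ a ∈ v, (encodeNat a).length ≤ m) :
    (encVec v).length ≤ v.length * (2 * m + 2) := by
  induction v with
  | nil => simp
  | cons a v ih =>
    rw [encVec_cons, List.length_append, length_dbl, List.length_cons, List.length_cons,
      List.length_cons, Nat.add_mul, Nat.one_mul]
    have ha := h a (by simp)
    have := ih (fun b hb => h b (by simp [hb]))
    omega

/-- Entries below `N` have numerals no longer than `N`'s. [folklore] -/
theorem length_encodeNat_le_of_lt_nat {a N : ℕ} (h : a < N) :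
    (encodeNat a).length ≤ (encodeNat N).length :=
  Brick.length_encodeNat_mono h.le

/-! ### Specifications: entrywise modular arithmetic -/

/-- Entrywise sum modulo `N` of two vectors (truncated to the shorter). [folklore] -/
def vaddMod (N : ℕ) (u v : List ℕ) : List ℕ := List.zipWith (fun a b => (a + b) % N) u v

/-- Entrywise difference modulo `N` (as `(a + (N - b)) mod N`, for entries `b ≤ N`). [folklore] -/
def vsubMod (N : ℕ) (u v : List ℕ) : List ℕ := List.zipWith (fun a b => (a + (N - b)) % N) u v

/-- Scalar multiple modulo `N`. [folklore] -/
def vscaleMod (N c : ℕ) (u : List ℕ) : List ℕ := u.map fun a => a * c % N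

/-- Negation modulo `N` of a residue (`0 ↦ 0`, `a ↦ N - a`). [folklore] -/
def negMod (N a : ℕ) : ℕ := (N - a) % N

/-- `vaddMod` on the empty vector. [folklore] -/
@[simp] theorem vaddMod_nil_left (N : ℕ) (v : List ℕ) : vaddMod N [] v = [] := rfl
/-- `vaddMod` entry by entry. [folklore] -/
@[simp] theorem vaddMod_cons (N a b : ℕ) (u v : List ℕ) :
    vaddMod N (a :: u) (b :: v) = (a + b) % N :: vaddMod N u v := rfl
/-- `vsubMod` on the empty vector. [folklore] -/
@[simp] theorem vsubMod_nil_left (N : ℕ) (v : List ℕ) : vsubMod N [] v = [] := rfl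
/-- `vsubMod` entry by entry. [folklore] -/
@[simp] theorem vsubMod_cons (N a b : ℕ) (u v : List ℕ) :
    vsubMod N (a :: u) (b :: v) = (a + (N - b)) % N :: vsubMod N u v := rfl
/-- `vscaleMod` on the empty vector. [folklore] -/
@[simp] theorem vscaleMod_nil (N c : ℕ) : vscaleMod N c [] = [] := rfl
/-- `vscaleMod` entry by entry. [folklore] -/
@[simp] theorem vscaleMod_cons (N c a : ℕ) (u : List ℕ) :
    vscaleMod N c (a :: u) = a * c % N :: vscaleMod N c u := rfl

/-- `vaddMod` truncates to the shorter vector. [folklore] -/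
@[simp] theorem length_vaddMod (N : ℕ) (u v : List ℕ) :
    (vaddMod N u v).length = min u.length v.length := List.length_zipWith
/-- `vsubMod` truncates to the shorter vector. [folklore] -/
@[simp] theorem length_vsubMod (N : ℕ) (u v : List ℕ) :
    (vsubMod N u v).length = min u.length v.length := List.length_zipWith
/-- `vscaleMod` preserves the length. [folklore] -/
@[simp] theorem length_vscaleMod (N c : ℕ) (u : List ℕ) :
    (vscaleMod N c u).length = u.length := List.length_map _

/-- Entries of a modular sum are reduced. [folklore] -/
theorem lt_of_mem_vaddMod {N : ℕ} (hN : 0 < N) {u v : List ℕ} {x : ℕ} (h : x ∈ vaddMod N u v) : x < N := by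
  unfold vaddMod at h
  induction u generalizing v with
  | nil => simp at h
  | cons a u ih =>
    cases v with
    | nil => simp at h
    | cons b v =>
      rw [List.zipWith_cons_cons, List.mem_cons] at h
      rcases h with rfl | h
      · exact Nat.mod_lt _ hN
      · exact ih h

/-- Entries of a modular difference are reduced. [folklore] -/
theorem lt_of_mem_vsubMod {N : ℕ} (hN : 0 < N) {u v : List ℕ} {x : ℕ} (h : x ∈ vsubMod N u v) : x < N := by
  unfold vsubMod at h
  induction u generalizing v with
  | nil => simp at h
  | cons a u ih =>
    cases v with
    | nil => simp at h
    | cons b v =>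
      rw [List.zipWith_cons_cons, List.mem_cons] at h
      rcases h with rfl | h
      · exact Nat.mod_lt _ hN
      · exact ih h

/-- Entries of a modular scalar multiple are reduced. [folklore] -/
theorem lt_of_mem_vscaleMod {N : ℕ} (hN : 0 < N) {c : ℕ} {u : List ℕ} {x : ℕ} (h : x ∈ vscaleMod N c u) :
    x < N := by
  unfold vscaleMod at h
  rw [List.mem_map] at h
  obtain ⟨a, -, rfl⟩ := h
  exact Nat.mod_lt _ hN

/-- The modular sum in `ZMod N`. [folklore] -/
theorem natCast_vaddMod_entry (N a b : ℕ) : (((a + b) % N : ℕ) : ZMod N) = (a : ZMod N) + b := by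
  rw [ZMod.natCast_mod, Nat.cast_add]

/-- The modular difference in `ZMod N` (for a reduced subtrahend). [folklore] -/
theorem natCast_vsubMod_entry (N a : ℕ) {b : ℕ} (hb : b ≤ N) :
    (((a + (N - b)) % N : ℕ) : ZMod N) = (a : ZMod N) - b := by
  rw [ZMod.natCast_mod, Nat.cast_add, Nat.cast_sub hb, ZMod.natCast_self, zero_sub, sub_eq_add_neg]

/-- The modular scalar multiple in `ZMod N`. [folklore] -/
theorem natCast_vscaleMod_entry (N a c : ℕ) : ((a * c % N : ℕ) : ZMod N) = (a : ZMod N) * c := by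
  rw [ZMod.natCast_mod, Nat.cast_mul]

/-- Negation modulo `N` in `ZMod N`. [folklore] -/
theorem natCast_negMod (N : ℕ) {a : ℕ} (ha : a ≤ N) : ((negMod N a : ℕ) : ZMod N) = -(a : ZMod N) := by
  rw [negMod, ZMod.natCast_mod, Nat.cast_sub ha, ZMod.natCast_self, zero_sub]

/-- `negMod` is reduced. [folklore] -/
theorem negMod_lt {N : ℕ} (hN : 0 < N) (a : ℕ) : negMod N a < N := Nat.mod_lt _ hN

/-- Coding of a concatenation of vectors. [folklore] -/
theorem encVec_append (u v : List ℕ) : encVec (u ++ v) = encVec u ++ encVec v := by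
  unfold encVec; rw [List.map_append, Com.encList_eq_flatMap, Com.encList_eq_flatMap,
    Com.encList_eq_flatMap, List.flatMap_append]

/-! ### Specification: multiplication by a power of `x` in `(ℤ/N)[x]/(x^L + 1)` -/

/-- `negShift N L e u`: the coefficient vector of `x^e · u(x)` in `(ℤ/N)[x]/(x^L + 1)`, for a
coefficient vector `u` of length `L` (constant term first) and `0 ≤ e < 2L`: for `e < L` the top
`e` coefficients wrap around to the bottom with a sign change; for `L ≤ e < 2L` it is the negative
of the shift by `e - L`. [von zur Gathen–Gerhard 2013, §8.3] [folklore] -/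
def negShift (N L e : ℕ) (u : List ℕ) : List ℕ :=
  if e < L then (u.drop (L - e)).map (negMod N) ++ u.take (L - e)
  else u.drop (2 * L - e) ++ (u.take (2 * L - e)).map (negMod N)

/-- `negShift` preserves the length of a vector of length `L`. [folklore] -/
theorem length_negShift {N L e : ℕ} {u : List ℕ} (hu : u.length = L) :
    (negShift N L e u).length = L := by
  unfold negShift
  split_ifs
  · simp only [List.length_append, List.length_map, List.length_drop, List.length_take, hu]; omega
  · simp only [List.length_append, List.length_map, List.length_drop, List.length_take, hu]; omega

/-- Entries of `negShift` are reduced when the input's are. [folklore] -/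
theorem lt_of_mem_negShift {N L e : ℕ} (hN : 0 < N) {u : List ℕ} (hu : ∀ a ∈ u, a < N) {x : ℕ}
    (hx : x ∈ negShift N L e u) : x < N := by
  unfold negShift at hx
  split_ifs at hx <;> simp only [List.mem_append, List.mem_map] at hx
  · rcases hx with ⟨a, -, rfl⟩ | h
    · exact negMod_lt hN a
    · exact hu x (List.mem_of_mem_take h)
  · rcases hx with h | ⟨a, -, rfl⟩
    · exact hu x (List.mem_of_mem_drop h)
    · exact negMod_lt hN a

/-! ### Register roles -/

/-- The register roles of the vector passes: input vectors `L1`, `L2`, destination `DST`,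
reversed accumulator `O`, hold accumulator `H`, entry scratch `A`, `B`, result `D`, flags `F`,
`G`, modulus `MD`, scalar `C`, token register `W`, reader scratch `TT`, unary counter `U`,
shift amount `E`, numeral scratch `S`, block length `LEN`. [folklore] -/
inductive VReg where
  | L1 | L2 | DST | O | H | A | B | D | F | G | MD | C | W | TT | U | E | S | LEN
  deriving DecidableEq, Repr

namespace Com

variable {β : Type} [DecidableEq β] (r : VReg ↪ β)

/-- The layer name of a role. [folklore] -/
abbrev vr (x : VReg) : EReg ⊕ β := Sum.inr (r x)

/-- Two register files agreeing on a list of registers and outside it are equal (the frame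
comparison used to close every simulation below). [folklore] -/
theorem _root_.Literature.Computability.Complexity.Regs.eq_of_on {ι : Type} [DecidableEq ι]
    {X Y : Regs ι} (l : List ι) (h₁ : ∀ k ∈ l, X k = Y k) (h₂ : ∀ k, k ∉ l → X k = Y k) : X = Y :=
  funext fun k => if hk : k ∈ l then h₁ k hk else h₂ k hk

/-! ### Entry scripts and their specifications -/

/-- `BinSpec r S N n cw g`: the numeric script `S`, started with reduced entries `a`, `b` in
`A`, `B`, the modulus `N` in `MD`, the constant `cw` in `C` and clean `D`, `F`, runs at
size bound `n`, empties `A` and `B` and leaves `encodeNat (g a b)` in `D`. [folklore] -/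
def BinSpec (S : NS β) (N n : ℕ) (cw : List Bool) (g : ℕ → ℕ → ℕ) : Prop :=
  ∀ (T : Regs β) (a b : ℕ), T (r .A) = encodeNat a → T (r .B) = encodeNat b →
    T (r .MD) = encodeNat N → T (r .C) = cw → T (r .D) = [] → T (r .F) = [] → a < N → b < N →
    S.ok T n ∧ S.eval T = Function.update (Function.update (Function.update T (r .A) []) (r .B) [])
      (r .D) (encodeNat (g a b))

/-- `UnSpec r S N n cw g`: the unary analogue (entry `a` in `A`, `B` clean). [folklore] -/
def UnSpec (S : NS β) (N n : ℕ) (cw : List Bool) (g : ℕ → ℕ) : Prop :=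
  ∀ (T : Regs β) (a : ℕ), T (r .A) = encodeNat a → T (r .B) = [] →
    T (r .MD) = encodeNat N → T (r .C) = cw → T (r .D) = [] → T (r .F) = [] → a < N →
    S.ok T n ∧ S.eval T = Function.update (Function.update T (r .A) []) (r .D) (encodeNat (g a))

/-- Length bookkeeping: a sum of two residues has a numeral of length `≤ |N| + 1`. [folklore] -/
theorem length_encodeNat_add_lt_two_mul {a b N : ℕ} (ha : a < N) (hb : b ≤ N) :
    (encodeNat (a + b)).length ≤ (encodeNat N).length + 1 := by
  have h2 : a + b < 2 * N := by omega
  have := Brick.length_encodeNat_mono (Nat.le_of_lt_succ (Nat.lt_succ_of_lt h2))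
  have h2N : (encodeNat (2 * N)).length = (encodeNat N).length + 1 := by
    rw [TM2Pass.length_encodeNat_eq_size, TM2Pass.length_encodeNat_eq_size]
    rw [show 2 * N = N <<< 1 by rw [Nat.shiftLeft_eq]; ring, Nat.size_shiftLeft (by omega)]
  omega

/-- The modular-addition script: `D := A + B; if MD ≤ D then D := D - MD; clear A, B`.
[folklore] -/
def addModS : NS β :=
  .seq (.op (.add (r .D) (r .A) (r .B)))
    (.seq (.op (.cmp (r .F) (r .D) (r .MD)))
      (.seq (.ite (r .F) (.op (.sub (r .D) (r .D) (r .MD))) .nop)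
        (.seq (.op (.clear (r .A))) (.op (.clear (r .B))))))

/-- **The modular-addition script adds modulo `N`.** (Knuth 1998, §4.3.1). [folklore] -/
theorem binSpec_addModS {N n : ℕ} (hn : (encodeNat N).length + 1 ≤ n) (cw : List Bool) :
    BinSpec r (addModS r) N n cw (fun a b => (a + b) % N) := by
  intro T a b hA hB hMD _ hD hF ha hb
  have hne : ∀ {i j : VReg}, i ≠ j → r i ≠ r j := fun h => r.injective.ne h
  have hla : (encodeNat a).length ≤ n := (length_encodeNat_le_of_lt_nat ha).trans (by omega)
  have hlb : (encodeNat b).length ≤ n := (length_encodeNat_le_of_lt_nat hb).trans (by omega)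
  have hlab1 : (encodeNat (a + b)).length ≤ n := (length_encodeNat_add_lt_two_mul ha hb.le).trans hn
  have hlab2 : (encodeNat (a + b)).length ≤ n + 1 := hlab1.trans (Nat.le_succ n)
  have hNn : (encodeNat N).length ≤ n := by omega
  have hFD : ∀ x, Function.update (Function.update T (r .D) x) (r .F) [] = Function.update T (r .D) x :=
    fun x => Function.update_eq_self_iff.2 (by rw [Function.update_of_ne (hne (by decide)), hF])
  have hfin : ∀ x, Function.update (Function.update (Function.update T (r .D) x) (r .A) []) (r .B) [] =
      Function.update (Function.update (Function.update T (r .A) []) (r .B) []) (r .D) x := by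
    intro x
    rw [Function.update_comm (hne (show VReg.D ≠ VReg.A by decide)),
      Function.update_comm (hne (show VReg.D ≠ VReg.B by decide))]
  by_cases hc : N ≤ a + b
  · have hres : (a + b) % N = a + b - N := by
      rw [Nat.mod_eq_sub_mod hc, Nat.mod_eq_of_lt (by omega)]
    have hlr : (encodeNat (a + b - N)).length ≤ n :=
      (length_encodeNat_le_of_lt_nat (show a + b - N < N by omega)).trans (by omega)
    refine ⟨by simp [addModS, hA, hB, hMD, hD, hF, hne, hla, hlb, hlab1, hlab2, hc, hNn], ?_⟩
    have he : (addModS r).eval T = Function.update (Function.update (Function.update (Function.update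
        (Function.update T (r .D) (encodeNat (a + b))) (r .F) []) (r .D) (encodeNat (a + b - N)))
        (r .A) []) (r .B) [] := by
      simp [addModS, hA, hB, hMD, hne, hc]
    beta_reduce
    rw [he, hFD, Function.update_idem, hres, hfin]
  · have hres : (a + b) % N = a + b := Nat.mod_eq_of_lt (by omega)
    refine ⟨by simp [addModS, hA, hB, hMD, hD, hF, hne, hla, hlb, hlab1, hlab2, hc, hNn], ?_⟩
    have he : (addModS r).eval T = Function.update (Function.update (Function.update (Function.update T
        (r .D) (encodeNat (a + b))) (r .F) []) (r .A) []) (r .B) [] := by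
      simp [addModS, hA, hB, hMD, hne, hc]
    beta_reduce
    rw [he, hFD, hres, hfin]

/-- The modular-subtraction script: `if B ≤ A then D := A - B else (D := A + MD; D := D - B);
clear A, B`. [folklore] -/
def subModS : NS β :=
  .seq (.op (.cmp (r .F) (r .A) (r .B)))
    (.seq (.ite (r .F) (.op (.sub (r .D) (r .A) (r .B)))
        (.seq (.op (.add (r .D) (r .A) (r .MD))) (.op (.sub (r .D) (r .D) (r .B)))))
      (.seq (.op (.clear (r .A))) (.op (.clear (r .B)))))

/-- **The modular-subtraction script subtracts modulo `N`** (result `(a + (N - b)) mod N`).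
(Knuth 1998, §4.3.1). [folklore] -/
theorem binSpec_subModS {N n : ℕ} (hn : (encodeNat N).length + 1 ≤ n) (cw : List Bool) :
    BinSpec r (subModS r) N n cw (fun a b => (a + (N - b)) % N) := by
  intro T a b hA hB hMD _ hD hF ha hb
  have hne : ∀ {i j : VReg}, i ≠ j → r i ≠ r j := fun h => r.injective.ne h
  have hla : (encodeNat a).length ≤ n := (length_encodeNat_le_of_lt_nat ha).trans (by omega)
  have hlb : (encodeNat b).length ≤ n := (length_encodeNat_le_of_lt_nat hb).trans (by omega)
  have hNn : (encodeNat N).length ≤ n := by omega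
  have hfin : ∀ x, Function.update (Function.update (Function.update T (r .D) x) (r .A) []) (r .B) [] =
      Function.update (Function.update (Function.update T (r .A) []) (r .B) []) (r .D) x := by
    intro x
    rw [Function.update_comm (hne (show VReg.D ≠ VReg.A by decide)),
      Function.update_comm (hne (show VReg.D ≠ VReg.B by decide))]
  have hFT : Function.update T (r .F) [] = T := Function.update_eq_self_iff.2 hF.symm
  by_cases hc : b ≤ a
  · have hres : (a + (N - b)) % N = a - b := by
      rw [show a + (N - b) = (a - b) + N by omega, Nat.add_mod_right, Nat.mod_eq_of_lt (by omega)]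
    have hlr : (encodeNat (a - b)).length ≤ n := (length_encodeNat_le_of_lt_nat (show a - b < N by omega)).trans (by omega)
    refine ⟨by simp [subModS, hA, hB, hD, hF, hne, hla, hlb, hc], ?_⟩
    have he : (subModS r).eval T = Function.update (Function.update (Function.update (Function.update T
        (r .F) []) (r .D) (encodeNat (a - b))) (r .A) []) (r .B) [] := by
      simp [subModS, hA, hB, hne, hc]
    beta_reduce
    rw [he, hFT, hres, hfin]
  · have hres : (a + (N - b)) % N = a + N - b := by
      rw [show a + (N - b) = a + N - b by omega, Nat.mod_eq_of_lt (by omega)]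
    have hl1 : (encodeNat (a + N)).length ≤ n + 1 := (length_encodeNat_add_lt_two_mul ha le_rfl).trans (by omega)
    have hl1' : (encodeNat (a + N)).length ≤ n := (length_encodeNat_add_lt_two_mul ha le_rfl).trans hn
    have hlr : (encodeNat (a + N - b)).length ≤ n + 1 :=
      ((length_encodeNat_le_of_lt_nat (show a + N - b < N by omega)).trans (by omega))
    refine ⟨by simp [subModS, hA, hB, hMD, hD, hF, hne, hla, hlb, hc, hNn, hl1, hl1', (by omega : b ≤ a + N)], ?_⟩
    have he : (subModS r).eval T = Function.update (Function.update (Function.update (Function.update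
        (Function.update T (r .F) []) (r .D) (encodeNat (a + N))) (r .D) (encodeNat (a + N - b)))
        (r .A) []) (r .B) [] := by
      simp [subModS, hA, hB, hMD, hne, hc]
    beta_reduce
    rw [he, hFT, Function.update_idem, hres, hfin]

/-- The scalar script: `D := A · C mod MD; clear A`. [folklore] -/
def scaleModS : NS β :=
  .seq (.op (.copy (r .A) (r .D))) (.seq (.op (.mulMod (r .D) (r .C) (r .MD))) (.op (.clear (r .A))))

/-- **The scalar script multiplies by the constant `c` modulo `N`.** (Knuth 1998,
§4.3.1). [folklore] -/
theorem unSpec_scaleModS {N n c : ℕ} (hn : (encodeNat N).length + 1 ≤ n) (hc : c < N) :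
    UnSpec r (scaleModS r) N n (encodeNat c) (fun a => a * c % N) := by
  intro T a hA _ hMD hC hD _ ha
  have hne : ∀ {i j : VReg}, i ≠ j → r i ≠ r j := fun h => r.injective.ne h
  have hN : 0 < N := by omega
  have hla : (encodeNat a).length ≤ n := (length_encodeNat_le_of_lt_nat ha).trans (by omega)
  have hlc : (encodeNat c).length ≤ n := (length_encodeNat_le_of_lt_nat hc).trans (by omega)
  have hNn : (encodeNat N).length ≤ n := by omega
  refine ⟨by simp [scaleModS, hA, hMD, hC, hD, hne, hla, hlc, hNn, hN], ?_⟩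
  have he : (scaleModS r).eval T = Function.update (Function.update (Function.update T (r .D) (encodeNat a))
      (r .D) (encodeNat (a * c % N))) (r .A) [] := by
    simp [scaleModS, hA, hMD, hC, hD, hne]
  rw [he, Function.update_idem, Function.update_comm (hne (by decide))]

/-- The negation script: `if A = 0 then skip else D := MD - A; clear A` (the test compares `A`
with the empty register `B`). [folklore] -/
def negModS : NS β :=
  .seq (.op (.cmp (r .F) (r .B) (r .A)))
    (.seq (.ite (r .F) .nop (.op (.sub (r .D) (r .MD) (r .A)))) (.op (.clear (r .A))))

/-- **The negation script negates modulo `N`.** [folklore] -/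
theorem unSpec_negModS {N n : ℕ} (hn : (encodeNat N).length + 1 ≤ n) (cw : List Bool) :
    UnSpec r (negModS r) N n cw (negMod N) := by
  intro T a hA hB hMD _ hD hF ha
  have hne : ∀ {i j : VReg}, i ≠ j → r i ≠ r j := fun h => r.injective.ne h
  have hla : (encodeNat a).length ≤ n := (length_encodeNat_le_of_lt_nat ha).trans (by omega)
  have hNn : (encodeNat N).length ≤ n := by omega
  have hFT : Function.update T (r .F) [] = T := Function.update_eq_self_iff.2 hF.symm
  by_cases hc : a = 0
  · subst hc
    have hres : negMod N 0 = 0 := by simp [negMod]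
    refine ⟨by simp [negModS, hA, hB, hF, hne, hla], ?_⟩
    have he : (negModS r).eval T = Function.update (Function.update T (r .F) []) (r .A) [] := by
      simp [negModS, hA, hB]
    rw [he, hFT, hres]
    symm
    refine Function.update_eq_self_iff.2 ?_
    rw [Function.update_of_ne (hne (by decide)), hD]; rfl
  · have hres : negMod N a = N - a := by rw [negMod, Nat.mod_eq_of_lt (by omega)]
    have hlr : (encodeNat (N - a)).length ≤ n + 1 := (length_encodeNat_le_of_lt_nat (show N - a < N by omega)).trans (by omega)
    refine ⟨by simp [negModS, hA, hB, hMD, hD, hF, hne, hla, hNn, hc, ha.le], ?_⟩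
    have he : (negModS r).eval T = Function.update (Function.update (Function.update T (r .F) [])
        (r .D) (encodeNat (N - a))) (r .A) [] := by
      simp [negModS, hA, hB, hMD, hne, hc]
    rw [he, hFT, hres, Function.update_comm (hne (by decide))]

/-- The identity script: `move A D`. [folklore] -/
def moveS : NS β := .op (.move (r .A) (r .D))

/-- **The identity script copies the entry.** [folklore] -/
theorem unSpec_moveS {N n : ℕ} (hn : (encodeNat N).length + 1 ≤ n) (cw : List Bool) :
    UnSpec r (moveS r) N n cw id := by
  intro T a hA _ _ _ hD _ ha
  have hne : ∀ {i j : VReg}, i ≠ j → r i ≠ r j := fun h => r.injective.ne h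
  have hla : (encodeNat a).length ≤ n := (length_encodeNat_le_of_lt_nat ha).trans (by omega)
  exact ⟨by simp [moveS, hA, hne, hla], by simp [moveS, hA, hD]⟩

/-! ### Generic entrywise passes -/

/-- Cost of one round of an entrywise pass whose script has cost coefficient `cS`. [folklore] -/
def vBodyCost (cS n : ℕ) : ℕ := (cS + 31) * (n + 1) ^ 3

/-- Cost of an entrywise pass over `len` entries. [folklore] -/
def vPassCost (cS n len : ℕ) : ℕ := len * ((cS + 38) * (n + 1) ^ 3) + 5

/-- The round of a unary pass: read the next entry of `L1` into `A`, run the script, emit `D`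
onto the accumulator `O`. [folklore] -/
def vUnBody (S : NS β) : Com (EReg ⊕ β) :=
  readItemTo (vr r .L1) (vr r .A) (vr r .W) (vr r .TT) ;; (S.com ;; emit (vr r .D) (vr r .O))

/-- The round of a binary pass: read the next entries of `L1`, `L2` into `A`, `B`, run the
script, emit `D` onto `O`. [folklore] -/
def vBinBody (S : NS β) : Com (EReg ⊕ β) :=
  readItemTo (vr r .L1) (vr r .A) (vr r .W) (vr r .TT) ;;
  (readItemTo (vr r .L2) (vr r .B) (vr r .W) (vr r .TT) ;; (S.com ;; emit (vr r .D) (vr r .O)))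

/-- **One round of a unary pass.** [folklore] -/
theorem runs_vUnBody {S : NS β} {N n : ℕ} {cw : List Bool} {g : ℕ → ℕ} (hS : UnSpec r S N n cw g)
    (hg : ∀ a, a < N → g a < N) (hn : (encodeNat N).length + 1 ≤ n) (T : Regs β) {a : ℕ} {u : List ℕ}
    (hL1 : T (r .L1) = encVec (a :: u)) (hMD : T (r .MD) = encodeNat N) (hC : T (r .C) = cw)
    (hA : T (r .A) = []) (hB : T (r .B) = []) (hD : T (r .D) = []) (hF : T (r .F) = [])
    (hW : T (r .W) = []) (hTT : T (r .TT) = []) (ha : a < N) :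
    Runs (vUnBody r S) (base T)
      (base (Function.update (Function.update T (r .L1) (encVec u))
        (r .O) (true :: false :: ((dbl (encodeNat (g a))).reverse ++ T (r .O)))))
      (vBodyCost S.cost n) := by
  have hne : ∀ {i j : VReg}, i ≠ j → r i ≠ r j := fun h => r.injective.ne h
  have hla : (encodeNat a).length ≤ n - 1 := (length_encodeNat_le_of_lt_nat ha).trans (by omega)
  have hld : (encodeNat (g a)).length ≤ n - 1 := (length_encodeNat_le_of_lt_nat (hg a ha)).trans (by omega)
  set T1 := Function.update (Function.update T (r .L1) (encVec u)) (r .A) (encodeNat a) with hT1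
  have h1 : Runs (readItemTo (vr r .L1) (vr r .A) (vr r .W) (vr r .TT)) (base T) (base T1)
      (11 * (encodeNat a).length + 9) :=
    (runs_readItemTo (by simp [hne]) (by simp [hne]) (by simp [hne]) (by simp [hne]) (by simp [hne])
      (encodeNat a) (encVec u) (base T) (by simp [hL1, encVec_cons]) (by simp [hW]) (by simp [hTT])).of_eq
      (by simp [hT1, hA]) le_rfl
  have hsp := hS T1 a (by simp [hT1]) (by simp [hT1, hne, hB]) (by simp [hT1, hne, hMD])
    (by simp [hT1, hne, hC]) (by simp [hT1, hne, hD]) (by simp [hT1, hne, hF]) ha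
  set T2 := Function.update (Function.update T1 (r .A) []) (r .D) (encodeNat (g a)) with hT2
  have h2 : Runs S.com (base T1) (base T2) (S.cost * (n + 1) ^ 3) := NS.runs_of_eq _ _ hsp.1 hsp.2 le_rfl
  set T3 := Function.update (Function.update T2 (r .D) []) (r .O)
    (true :: false :: ((dbl (encodeNat (g a))).reverse ++ T (r .O))) with hT3
  have h3 : Runs (emit (vr r .D) (vr r .O)) (base T2) (base T3) (4 * (encodeNat (g a)).length + 3) :=
    (runs_emit (h := vr r .D) (o := vr r .O) (by simp [hne]) (base T2)).of_eq
      (by simp [hT3, hT2, hT1, hne, dbl]) (by simp [hT2])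
  refine (h1.seq (h2.seq h3)).of_eq ?_ ?_
  · congr 1
    refine Regs.eq_of_on [r .L1, r .O, r .A, r .D] ?_ ?_
    · intro k hk
      simp only [List.mem_cons, List.not_mem_nil, or_false] at hk
      rcases hk with rfl | rfl | rfl | rfl <;> simp [hT3, hT2, hT1, hne, hA, hD]
    · intro k hk
      simp only [List.mem_cons, List.not_mem_nil, or_false, not_or] at hk
      obtain ⟨h₁, h₂, h₃, h₄⟩ := hk
      simp [hT3, hT2, hT1, h₁, h₂, h₃, h₄]
  · have hc : n + 1 ≤ (n + 1) ^ 3 := succ_le_cube n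
    rw [vBodyCost, Nat.add_mul]
    omega

/-- **One round of a binary pass.** [folklore] -/
theorem runs_vBinBody {S : NS β} {N n : ℕ} {cw : List Bool} {g : ℕ → ℕ → ℕ}
    (hS : BinSpec r S N n cw g) (hg : ∀ a b, a < N → b < N → g a b < N)
    (hn : (encodeNat N).length + 1 ≤ n) (T : Regs β) {a b : ℕ} {u v : List ℕ}
    (hL1 : T (r .L1) = encVec (a :: u)) (hL2 : T (r .L2) = encVec (b :: v))
    (hMD : T (r .MD) = encodeNat N) (hC : T (r .C) = cw) (hA : T (r .A) = []) (hB : T (r .B) = [])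
    (hD : T (r .D) = []) (hF : T (r .F) = []) (hW : T (r .W) = []) (hTT : T (r .TT) = [])
    (ha : a < N) (hb : b < N) :
    Runs (vBinBody r S) (base T)
      (base (Function.update (Function.update (Function.update T (r .L1) (encVec u)) (r .L2) (encVec v))
        (r .O) (true :: false :: ((dbl (encodeNat (g a b))).reverse ++ T (r .O)))))
      (vBodyCost S.cost n) := by
  have hne : ∀ {i j : VReg}, i ≠ j → r i ≠ r j := fun h => r.injective.ne h
  have hla : (encodeNat a).length ≤ n - 1 := (length_encodeNat_le_of_lt_nat ha).trans (by omega)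
  have hlb : (encodeNat b).length ≤ n - 1 := (length_encodeNat_le_of_lt_nat hb).trans (by omega)
  have hld : (encodeNat (g a b)).length ≤ n - 1 :=
    (length_encodeNat_le_of_lt_nat (hg a b ha hb)).trans (by omega)
  set T1 := Function.update (Function.update T (r .L1) (encVec u)) (r .A) (encodeNat a) with hT1
  have h1 : Runs (readItemTo (vr r .L1) (vr r .A) (vr r .W) (vr r .TT)) (base T) (base T1)
      (11 * (encodeNat a).length + 9) :=
    (runs_readItemTo (by simp [hne]) (by simp [hne]) (by simp [hne]) (by simp [hne]) (by simp [hne])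
      (encodeNat a) (encVec u) (base T) (by simp [hL1, encVec_cons]) (by simp [hW]) (by simp [hTT])).of_eq
      (by simp [hT1, hA]) le_rfl
  set T2 := Function.update (Function.update T1 (r .L2) (encVec v)) (r .B) (encodeNat b) with hT2
  have h2 : Runs (readItemTo (vr r .L2) (vr r .B) (vr r .W) (vr r .TT)) (base T1) (base T2)
      (11 * (encodeNat b).length + 9) :=
    (runs_readItemTo (by simp [hne]) (by simp [hne]) (by simp [hne]) (by simp [hne]) (by simp [hne])
      (encodeNat b) (encVec v) (base T1) (by simp [hT1, hL2, hne, encVec_cons]) (by simp [hT1, hne, hW])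
      (by simp [hT1, hne, hTT])).of_eq (by simp [hT2, hT1, hne, hB]) le_rfl
  have hsp := hS T2 a b (by simp [hT2, hT1, hne]) (by simp [hT2]) (by simp [hT2, hT1, hne, hMD])
    (by simp [hT2, hT1, hne, hC]) (by simp [hT2, hT1, hne, hD]) (by simp [hT2, hT1, hne, hF]) ha hb
  set T3 := Function.update (Function.update (Function.update T2 (r .A) []) (r .B) []) (r .D)
    (encodeNat (g a b)) with hT3
  have h3 : Runs S.com (base T2) (base T3) (S.cost * (n + 1) ^ 3) := NS.runs_of_eq _ _ hsp.1 hsp.2 le_rfl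
  set T4 := Function.update (Function.update T3 (r .D) []) (r .O)
    (true :: false :: ((dbl (encodeNat (g a b))).reverse ++ T (r .O))) with hT4
  have h4 : Runs (emit (vr r .D) (vr r .O)) (base T3) (base T4) (4 * (encodeNat (g a b)).length + 3) :=
    (runs_emit (h := vr r .D) (o := vr r .O) (by simp [hne]) (base T3)).of_eq
      (by simp [hT4, hT3, hT2, hT1, hne, dbl]) (by simp [hT3])
  refine (h1.seq (h2.seq (h3.seq h4))).of_eq ?_ ?_
  · congr 1
    refine Regs.eq_of_on [r .L1, r .L2, r .O, r .A, r .B, r .D] ?_ ?_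
    · intro k hk
      simp only [List.mem_cons, List.not_mem_nil, or_false] at hk
      rcases hk with rfl | rfl | rfl | rfl | rfl | rfl <;> simp [hT4, hT3, hT2, hT1, hne, hA, hB, hD]
    · intro k hk
      simp only [List.mem_cons, List.not_mem_nil, or_false, not_or] at hk
      obtain ⟨h₁, h₂, h₃, h₄, h₅, h₆⟩ := hk
      simp [hT4, hT3, hT2, hT1, h₁, h₂, h₃, h₄, h₅, h₆]
  · have hc : n + 1 ≤ (n + 1) ^ 3 := succ_le_cube n
    rw [vBodyCost, Nat.add_mul]
    omega

/-- Length of a reversed accumulator of reduced entries. [folklore] -/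
theorem length_outRev_map_le {E : List ℕ} {N n : ℕ} (hE : ∀ d ∈ E, d < N)
    (hn : (encodeNat N).length + 1 ≤ n) : (outRev (E.map encodeNat)).length ≤ E.length * (2 * n) := by
  rw [← List.length_reverse, reverse_outRev_map]
  refine (length_encVec_le (m := n - 1) fun d hd => ?_).trans (Nat.mul_le_mul_left _ (by omega))
  exact (length_encodeNat_le_of_lt_nat (hE d hd)).trans (by omega)

/-- The entries of a `zip` lie in the two lists. [folklore] -/
theorem forall_zip_lt {u v : List ℕ} {N : ℕ} (hu : ∀ a ∈ u, a < N) (hv : ∀ b ∈ v, b < N) :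
    ∀ p ∈ u.zip v, p.1 < N ∧ p.2 < N :=
  fun _ hp => ⟨hu _ (List.of_mem_zip hp).1, hv _ (List.of_mem_zip hp).2⟩

/-! ### Rounds abstractly: frame invariants and the three loop rules -/

/-- `FrameInv r Inv`: the predicate `Inv` on outer register files ignores the registers a
streaming round rewrites (`L1`, `L2`, `O`) and the unary counter `U`. [folklore] -/
def FrameInv (Inv : Regs β → Prop) : Prop :=
  ∀ (T : Regs β) (x : VReg) (w : List Bool), x = .L1 ∨ x = .L2 ∨ x = .O ∨ x = .U → Inv T →
    Inv (Function.update T (r x) w)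

/-- `UnRound r body Inv N g c`: under `Inv`, from `L1 = encVec (a :: u)` with `a < N`, the
program `body` consumes the entry and pushes the emitted item of `encodeNat (g a)` onto `O`,
changing nothing else, within `c` steps. [folklore] -/
def UnRound (body : Com (EReg ⊕ β)) (Inv : Regs β → Prop) (N : ℕ) (g : ℕ → ℕ) (c : ℕ) : Prop :=
  ∀ (T : Regs β) (a : ℕ) (u : List ℕ), Inv T → T (r .L1) = encVec (a :: u) → a < N →
    Runs body (base T) (base (Function.update (Function.update T (r .L1) (encVec u)) (r .O)
      (true :: false :: ((dbl (encodeNat (g a))).reverse ++ T (r .O))))) c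

/-- `BinRound r body Inv N g c`: the binary analogue, consuming the first entries of `L1` and
`L2`. [folklore] -/
def BinRound (body : Com (EReg ⊕ β)) (Inv : Regs β → Prop) (N : ℕ) (g : ℕ → ℕ → ℕ) (c : ℕ) : Prop :=
  ∀ (T : Regs β) (a b : ℕ) (u v : List ℕ), Inv T → T (r .L1) = encVec (a :: u) →
    T (r .L2) = encVec (b :: v) → a < N → b < N →
    Runs body (base T) (base (Function.update (Function.update (Function.update T (r .L1) (encVec u))
      (r .L2) (encVec v)) (r .O) (true :: false :: ((dbl (encodeNat (g a b))).reverse ++ T (r .O))))) c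

/-- The invariant of the script rounds: modulus and constant in place, scratch clean. [folklore] -/
def ScriptInv (N : ℕ) (cw : List Bool) (T : Regs β) : Prop :=
  T (r .MD) = encodeNat N ∧ T (r .C) = cw ∧ T (r .A) = [] ∧ T (r .B) = [] ∧ T (r .D) = [] ∧
    T (r .F) = [] ∧ T (r .W) = [] ∧ T (r .TT) = []

/-- The script invariant is a frame invariant. [folklore] -/
theorem frameInv_scriptInv (N : ℕ) (cw : List Bool) : FrameInv r (ScriptInv r N cw) := by
  have hne : ∀ {i j : VReg}, i ≠ j → r i ≠ r j := fun h => r.injective.ne h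
  rintro T x w hx ⟨h1, h2, h3, h4, h5, h6, h7, h8⟩
  rcases hx with rfl | rfl | rfl | rfl <;> exact ⟨by simp [hne, h1], by simp [hne, h2], by simp [hne, h3],
    by simp [hne, h4], by simp [hne, h5], by simp [hne, h6], by simp [hne, h7], by simp [hne, h8]⟩

/-- The script round `vUnBody S` is a unary round under the script invariant. [folklore] -/
theorem unRound_vUnBody {S : NS β} {N n : ℕ} {cw : List Bool} {g : ℕ → ℕ} (hS : UnSpec r S N n cw g)
    (hg : ∀ a, a < N → g a < N) (hn : (encodeNat N).length + 1 ≤ n) :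
    UnRound r (vUnBody r S) (ScriptInv r N cw) N g (vBodyCost S.cost n) :=
  fun T _ _ ⟨hMD, hC, hA, hB, hD, hF, hW, hTT⟩ hL1 ha =>
    runs_vUnBody r hS hg hn T hL1 hMD hC hA hB hD hF hW hTT ha

/-- The script round `vBinBody S` is a binary round under the script invariant. [folklore] -/
theorem binRound_vBinBody {S : NS β} {N n : ℕ} {cw : List Bool} {g : ℕ → ℕ → ℕ}
    (hS : BinSpec r S N n cw g) (hg : ∀ a b, a < N → b < N → g a b < N)
    (hn : (encodeNat N).length + 1 ≤ n) :
    BinRound r (vBinBody r S) (ScriptInv r N cw) N g (vBodyCost S.cost n) :=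
  fun T _ _ _ _ ⟨hMD, hC, hA, hB, hD, hF, hW, hTT⟩ hL1 hL2 ha hb =>
    runs_vBinBody r hS hg hn T hL1 hL2 hMD hC hA hB hD hF hW hTT ha hb

/-- **The unary stream-loop rule**: from `L1 = encVec u` and `O = o₀`, the token loop of a unary
round empties `L1` and leaves `outRev ((u.map g).map encodeNat) ++ o₀` in `O`. [folklore] -/
theorem runs_streamLoop_un {body : Com (EReg ⊕ β)} {Inv : Regs β → Prop} {N : ℕ} {g : ℕ → ℕ} {c : ℕ}
    (hFr : FrameInv r Inv) (hb : UnRound r body Inv N g c) (T : Regs β) {u : List ℕ}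
    (hu : ∀ a ∈ u, a < N) (hI : Inv T) (hL1 : T (r .L1) = encVec u) (hW : T (r .W) = []) :
    Runs (streamLoop (vr r .L1) (vr r .W) body) (base T)
      (base (Function.update (Function.update T (r .L1) []) (r .O)
        (outRev ((u.map g).map encodeNat) ++ T (r .O))))
      (u.length * (c + 6) + 4) := by
  have hne : ∀ {i j : VReg}, i ≠ j → r i ≠ r j := fun h => r.injective.ne h
  let st : List ℕ → List ℕ → Regs β := fun done l =>
    Function.update (Function.update T (r .L1) (encVec l)) (r .O) (outRev ((done.map g).map encodeNat) ++ T (r .O))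
  have hIst : ∀ done l, Inv (st done l) := fun done l =>
    hFr _ .O _ (by simp) (hFr _ .L1 _ (by simp) hI)
  have hloop := runs_streamLoop (L := vr r .L1) (w := vr r .W) (by simp [hne]) (body := body)
    encVec rfl (fun a l => encVec_cons_ne_nil _ _)
    (fun l R => ∃ done, done ++ l = u ∧ R = base (st done l)) (fun _ => c)
    (by
      rintro a l R ⟨done, hdl, rfl⟩ - -
      have hal : a ∈ u := by rw [← hdl]; simp
      have hb1 := hb (st done (a :: l)) a l (hIst _ _) (by simp [st, hne]) (hu a hal)
      have heq : base (Function.update (Function.update (st done (a :: l)) (r .L1) (encVec l)) (r .O)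
          (true :: false :: ((dbl (encodeNat (g a))).reverse ++ st done (a :: l) (r .O)))) =
          base (st (done ++ [a]) l) := by
        congr 1
        refine Regs.eq_of_on [r .L1, r .O] ?_ ?_
        · intro k hk
          simp only [List.mem_cons, List.not_mem_nil, or_false] at hk
          rcases hk with rfl | rfl
          · simp [st, hne]
          · simp [st, List.map_append, outRev_append, dbl]
        · intro k hk
          simp only [List.mem_cons, List.not_mem_nil, or_false, not_or] at hk
          obtain ⟨h₁, h₂⟩ := hk
          simp [st, h₁, h₂]
      exact ⟨_, hb1.of_eq heq le_rfl, by simp [st, hne], by simp [st, hne, hW], done ++ [a], by simp [hdl], rfl⟩)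
    u (base (st [] u)) ⟨[], rfl, rfl⟩ (by simp [st]) (by simp [st, hne, hW])
  obtain ⟨R', hl, -, -, done, hdone, rfl⟩ := hloop
  rw [List.append_nil] at hdone
  subst hdone
  have hst0 : base (st [] done) = base T := by
    congr 1
    refine Regs.eq_of_on [r .L1, r .O] ?_ ?_
    · intro k hk
      simp only [List.mem_cons, List.not_mem_nil, or_false] at hk
      rcases hk with rfl | rfl
      · simp [st, hne, hL1]
      · simp [st]
    · intro k hk
      simp only [List.mem_cons, List.not_mem_nil, or_false, not_or] at hk
      obtain ⟨h₁, h₂⟩ := hk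
      simp [st, h₁, h₂]
  rw [hst0] at hl
  refine hl.of_eq rfl ?_
  simp only [List.map_const', List.sum_replicate, smul_eq_mul]
  rw [Nat.mul_add]; omega

/-- **The unary counted-loop rule**: with `U = 1ᵏ` and `L1 = encVec (u₁ ++ u₂)`, `|u₁| = k`, the
counted loop of a unary round moves exactly the entries of `u₁` (emitted onto `O`), leaving
`L1 = encVec u₂` and `U` empty. [folklore] -/
theorem runs_countLoop_un {body : Com (EReg ⊕ β)} {Inv : Regs β → Prop} {N : ℕ} {g : ℕ → ℕ} {c : ℕ}
    (hFr : FrameInv r Inv) (hb : UnRound r body Inv N g c) (T : Regs β) {u₁ u₂ : List ℕ}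
    (hu : ∀ a ∈ u₁, a < N) (hI : Inv T) (hL1 : T (r .L1) = encVec (u₁ ++ u₂))
    (hU : T (r .U) = List.replicate u₁.length true) :
    Runs (countLoop (vr r .U) body) (base T)
      (base (Function.update (Function.update (Function.update T (r .L1) (encVec u₂)) (r .U) []) (r .O)
        (outRev ((u₁.map g).map encodeNat) ++ T (r .O))))
      (u₁.length * (c + 2) + 1) := by
  have hne : ∀ {i j : VReg}, i ≠ j → r i ≠ r j := fun h => r.injective.ne h
  -- state: `done` emitted, `l` still to move (then `u₂`), `k = |l|` tokens
  let st : List ℕ → List ℕ → Regs β := fun done l =>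
    Function.update (Function.update (Function.update T (r .L1) (encVec (l ++ u₂))) (r .U)
      (List.replicate l.length true)) (r .O) (outRev ((done.map g).map encodeNat) ++ T (r .O))
  have hIst : ∀ done l w, Inv (Function.update (st done l) (r .U) w) := fun done l w =>
    hFr _ .U _ (by simp) (hFr _ .O _ (by simp) (hFr _ .U _ (by simp) (hFr _ .L1 _ (by simp) hI)))
  have hloop := runs_countLoop (U := vr r .U) (body := body)
    (fun k R => ∃ done l, done ++ l = u₁ ∧ l.length = k ∧ R = base (st done l)) c
    (by
      rintro k R ⟨done, l, hdl, hlen, rfl⟩ -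
      obtain ⟨a, l, rfl⟩ : ∃ a l', l = a :: l' := by
        cases l with
        | nil => simp at hlen
        | cons a l' => exact ⟨a, l', rfl⟩
      have hal : a ∈ u₁ := by rw [← hdl]; simp
      simp only [List.length_cons, Nat.add_right_cancel_iff] at hlen
      have hb1 := hb (Function.update (st done (a :: l)) (r .U) (List.replicate k true)) a (l ++ u₂)
        (hIst _ _ _) (by simp [st, hne]) (hu a hal)
      have heq : base (Function.update (Function.update (Function.update (st done (a :: l)) (r .U)
          (List.replicate k true)) (r .L1) (encVec (l ++ u₂))) (r .O)
          (true :: false :: ((dbl (encodeNat (g a))).reverse ++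
            Function.update (st done (a :: l)) (r .U) (List.replicate k true) (r .O)))) =
          base (st (done ++ [a]) l) := by
        congr 1
        refine Regs.eq_of_on [r .L1, r .O, r .U] ?_ ?_
        · intro x hx
          simp only [List.mem_cons, List.not_mem_nil, or_false] at hx
          rcases hx with rfl | rfl | rfl
          · simp [st, hne]
          · simp [st, hne, List.map_append, outRev_append, dbl]
          · simp [st, hne, hlen]
        · intro x hx
          simp only [List.mem_cons, List.not_mem_nil, or_false, not_or] at hx
          obtain ⟨h₁, h₂, h₃⟩ := hx
          simp [st, h₁, h₂, h₃]
      refine ⟨_, ?_, by simp [st, hne, hlen], done ++ [a], l, by simp [hdl], hlen, rfl⟩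
      have : Function.update (base (st done (a :: l))) (vr r .U) (List.replicate k true) =
          base (Function.update (st done (a :: l)) (r .U) (List.replicate k true)) := by simp
      rw [this]
      exact hb1.of_eq heq le_rfl)
    u₁.length (base (st [] u₁)) ⟨[], u₁, rfl, rfl, rfl⟩ (by simp [st, hne])
  obtain ⟨R', hl, -, done, l, hdl, hlen, rfl⟩ := hloop
  obtain rfl : l = [] := List.eq_nil_of_length_eq_zero hlen
  rw [List.append_nil] at hdl
  subst hdl
  have hst0 : base (st [] done) = base T := by
    congr 1
    refine Regs.eq_of_on [r .L1, r .O, r .U] ?_ ?_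
    · intro x hx
      simp only [List.mem_cons, List.not_mem_nil, or_false] at hx
      rcases hx with rfl | rfl | rfl
      · simp [st, hne, hL1]
      · simp [st]
      · simp [st, hne, hU]
    · intro x hx
      simp only [List.mem_cons, List.not_mem_nil, or_false, not_or] at hx
      obtain ⟨h₁, h₂, h₃⟩ := hx
      simp [st, h₁, h₂, h₃]
  rw [hst0] at hl
  exact hl.of_eq rfl le_rfl

/-- **The binary stream-loop rule**: from `L1 = encVec u`, `L2 = encVec v` (same length) and
`O = o₀`, the token loop of a binary round empties both and leaves
`outRev ((zipWith g u v).map encodeNat) ++ o₀` in `O`. [folklore] -/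
theorem runs_streamLoop_bin {body : Com (EReg ⊕ β)} {Inv : Regs β → Prop} {N : ℕ} {g : ℕ → ℕ → ℕ}
    {c : ℕ} (hFr : FrameInv r Inv) (hb : BinRound r body Inv N g c) (T : Regs β) {u v : List ℕ}
    (huv : u.length = v.length) (hu : ∀ a ∈ u, a < N) (hv : ∀ b ∈ v, b < N) (hI : Inv T)
    (hL1 : T (r .L1) = encVec u) (hL2 : T (r .L2) = encVec v) (hW : T (r .W) = []) :
    Runs (streamLoop (vr r .L1) (vr r .W) body) (base T)
      (base (Function.update (Function.update (Function.update T (r .L1) []) (r .L2) []) (r .O)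
        (outRev ((List.zipWith g u v).map encodeNat) ++ T (r .O))))
      (u.length * (c + 6) + 4) := by
  have hne : ∀ {i j : VReg}, i ≠ j → r i ≠ r j := fun h => r.injective.ne h
  let f : ℕ × ℕ → ℕ := fun p => g p.1 p.2
  let st : List (ℕ × ℕ) → List (ℕ × ℕ) → Regs β := fun done l =>
    Function.update (Function.update (Function.update T (r .L1) (encVec (l.map Prod.fst)))
      (r .L2) (encVec (l.map Prod.snd))) (r .O) (outRev ((done.map f).map encodeNat) ++ T (r .O))
  have hIst : ∀ done l, Inv (st done l) := fun done l =>
    hFr _ .O _ (by simp) (hFr _ .L2 _ (by simp) (hFr _ .L1 _ (by simp) hI))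
  have hfull := forall_zip_lt hu hv
  have hres : (u.zip v).map f = List.zipWith g u v := by
    rw [List.zip_eq_zipWith, List.map_zipWith]
  have hloop := runs_streamLoop (L := vr r .L1) (w := vr r .W) (by simp [hne]) (body := body)
    (fun l : List (ℕ × ℕ) => encVec (l.map Prod.fst)) rfl (fun a l => encVec_cons_ne_nil _ _)
    (fun l R => ∃ done, done ++ l = u.zip v ∧ R = base (st done l)) (fun _ => c)
    (by
      rintro a l R ⟨done, hdl, rfl⟩ - -
      have hal : a ∈ u.zip v := by rw [← hdl]; simp
      have hb1 := hb (st done (a :: l)) a.1 a.2 (l.map Prod.fst) (l.map Prod.snd) (hIst _ _)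
        (by simp [st, hne]) (by simp [st, hne]) (hfull a hal).1 (hfull a hal).2
      have heq : base (Function.update (Function.update (Function.update (st done (a :: l)) (r .L1)
          (encVec (l.map Prod.fst))) (r .L2) (encVec (l.map Prod.snd))) (r .O)
          (true :: false :: ((dbl (encodeNat (g a.1 a.2))).reverse ++ st done (a :: l) (r .O)))) =
          base (st (done ++ [a]) l) := by
        congr 1
        refine Regs.eq_of_on [r .L1, r .L2, r .O] ?_ ?_
        · intro k hk
          simp only [List.mem_cons, List.not_mem_nil, or_false] at hk
          rcases hk with rfl | rfl | rfl
          · simp [st, hne]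
          · simp [st, hne]
          · simp [st, f, List.map_append, outRev_append, dbl]
        · intro k hk
          simp only [List.mem_cons, List.not_mem_nil, or_false, not_or] at hk
          obtain ⟨h₁, h₂, h₃⟩ := hk
          simp [st, h₁, h₂, h₃]
      exact ⟨_, hb1.of_eq heq le_rfl, by simp [st, hne], by simp [st, hne, hW], done ++ [a], by simp [hdl], rfl⟩)
    (u.zip v) (base (st [] (u.zip v))) ⟨[], rfl, rfl⟩ (by simp [st]) (by simp [st, hne, hW])
  obtain ⟨R', hl, -, -, done, hdone, rfl⟩ := hloop
  rw [List.append_nil] at hdone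
  subst hdone
  have hst0 : base (st [] (u.zip v)) = base T := by
    congr 1
    refine Regs.eq_of_on [r .L1, r .L2, r .O] ?_ ?_
    · intro k hk
      simp only [List.mem_cons, List.not_mem_nil, or_false] at hk
      rcases hk with rfl | rfl | rfl
      · simp [st, hne, hL1, List.map_fst_zip, huv.le]
      · simp [st, hne, hL2, List.map_snd_zip, huv.ge]
      · simp [st]
    · intro k hk
      simp only [List.mem_cons, List.not_mem_nil, or_false, not_or] at hk
      obtain ⟨h₁, h₂, h₃⟩ := hk
      simp [st, h₁, h₂, h₃]
  rw [hst0] at hl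
  refine hl.of_eq ?_ ?_
  · simp only [st, List.map_nil, encVec_nil, hres]
  · simp only [List.map_const', List.sum_replicate, smul_eq_mul, List.length_zip, huv, min_self]
    rw [Nat.mul_add]; omega

/-! ### Generic passes: a loop, then the accumulator is poured onto the destination -/

/-- A unary pass: the token loop of `vUnBody`, then the accumulator is poured onto `DST`.
[folklore] -/
def vUnPass (S : NS β) : Com (EReg ⊕ β) :=
  streamLoop (vr r .L1) (vr r .W) (vUnBody r S) ;; pour (vr r .O) (vr r .DST)

/-- A binary pass: the token loop of `vBinBody`, then the accumulator is poured onto `DST`.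
[folklore] -/
def vBinPass (S : NS β) : Com (EReg ⊕ β) :=
  streamLoop (vr r .L1) (vr r .W) (vBinBody r S) ;; pour (vr r .O) (vr r .DST)

/-- **The unary pass.** From `L1 = encVec u` (entries `< N`), modulus and constant in place and
clean scratch, `vUnPass S` empties `L1` and puts `encVec (u.map g)` on top of `DST`, within
`vPassCost S.cost n |u|`. [folklore] -/
theorem runs_vUnPass {S : NS β} {N n : ℕ} {cw : List Bool} {g : ℕ → ℕ} (hS : UnSpec r S N n cw g)
    (hg : ∀ a, a < N → g a < N) (hn : (encodeNat N).length + 1 ≤ n) (T : Regs β) {u : List ℕ}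
    (hu : ∀ a ∈ u, a < N) (hL1 : T (r .L1) = encVec u) (hMD : T (r .MD) = encodeNat N)
    (hC : T (r .C) = cw) (hA : T (r .A) = []) (hB : T (r .B) = []) (hD : T (r .D) = [])
    (hF : T (r .F) = []) (hW : T (r .W) = []) (hTT : T (r .TT) = []) (hO : T (r .O) = []) :
    Runs (vUnPass r S) (base T)
      (base (Function.update (Function.update T (r .L1) []) (r .DST) (encVec (u.map g) ++ T (r .DST))))
      (vPassCost S.cost n u.length) := by
  have hne : ∀ {i j : VReg}, i ≠ j → r i ≠ r j := fun h => r.injective.ne h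
  have hl := runs_streamLoop_un r (frameInv_scriptInv r N cw) (unRound_vUnBody r hS hg hn) T hu
    ⟨hMD, hC, hA, hB, hD, hF, hW, hTT⟩ hL1 hW
  rw [hO, List.append_nil] at hl
  set T1 := Function.update (Function.update T (r .L1) []) (r .O) (outRev ((u.map g).map encodeNat)) with hT1
  have hp := runs_opour (a := r .O) (b := r .DST) (hne (by decide)) T1
  have hglt : ∀ d ∈ u.map g, d < N := by
    intro d hd; rw [List.mem_map] at hd; obtain ⟨a, ha, rfl⟩ := hd; exact hg a (hu a ha)
  have hOlen : (T1 (r .O)).length ≤ u.length * (2 * n) := by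
    simp only [hT1, Function.update_self]
    exact (length_outRev_map_le hglt hn).trans (by rw [List.length_map])
  have hrev : (T1 (r .O)).reverse = encVec (u.map g) := by
    simp only [hT1, Function.update_self]; exact reverse_outRev_map _
  refine (hl.seq hp).of_eq ?_ ?_
  · congr 1
    refine Regs.eq_of_on [r .L1, r .O, r .DST] ?_ ?_
    · intro k hk
      simp only [List.mem_cons, List.not_mem_nil, or_false] at hk
      rcases hk with rfl | rfl | rfl
      · simp [hT1, hne]
      · simp [hT1, hne, hO]
      · rw [Function.update_self, Function.update_self, hrev]
        simp [hT1, hne]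
    · intro k hk
      simp only [List.mem_cons, List.not_mem_nil, or_false, not_or] at hk
      obtain ⟨h₁, h₂, h₃⟩ := hk
      simp [hT1, h₁, h₂, h₃]
  · unfold vPassCost vBodyCost
    have hc : u.length * (n + 1) ≤ u.length * (n + 1) ^ 3 := Nat.mul_le_mul_left _ (succ_le_cube n)
    nlinarith [hOlen, hc]

/-- **The binary pass.** From `L1 = encVec u`, `L2 = encVec v` (same length, entries `< N`),
modulus and constant in place and clean scratch, `vBinPass S` empties `L1`, `L2` and puts
`encVec (zipWith g u v)` on top of `DST`, within `vPassCost S.cost n |u|`. [folklore] -/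
theorem runs_vBinPass {S : NS β} {N n : ℕ} {cw : List Bool} {g : ℕ → ℕ → ℕ}
    (hS : BinSpec r S N n cw g) (hg : ∀ a b, a < N → b < N → g a b < N)
    (hn : (encodeNat N).length + 1 ≤ n) (T : Regs β) {u v : List ℕ} (huv : u.length = v.length)
    (hu : ∀ a ∈ u, a < N) (hv : ∀ b ∈ v, b < N) (hL1 : T (r .L1) = encVec u)
    (hL2 : T (r .L2) = encVec v) (hMD : T (r .MD) = encodeNat N) (hC : T (r .C) = cw)
    (hA : T (r .A) = []) (hB : T (r .B) = []) (hD : T (r .D) = []) (hF : T (r .F) = [])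
    (hW : T (r .W) = []) (hTT : T (r .TT) = []) (hO : T (r .O) = []) :
    Runs (vBinPass r S) (base T)
      (base (Function.update (Function.update (Function.update T (r .L1) []) (r .L2) [])
        (r .DST) (encVec (List.zipWith g u v) ++ T (r .DST)))) (vPassCost S.cost n u.length) := by
  have hne : ∀ {i j : VReg}, i ≠ j → r i ≠ r j := fun h => r.injective.ne h
  have hl := runs_streamLoop_bin r (frameInv_scriptInv r N cw) (binRound_vBinBody r hS hg hn) T huv hu hv
    ⟨hMD, hC, hA, hB, hD, hF, hW, hTT⟩ hL1 hL2 hW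
  rw [hO, List.append_nil] at hl
  set T1 := Function.update (Function.update (Function.update T (r .L1) []) (r .L2) []) (r .O)
    (outRev ((List.zipWith g u v).map encodeNat)) with hT1
  have hp := runs_opour (a := r .O) (b := r .DST) (hne (by decide)) T1
  have hglt : ∀ d ∈ List.zipWith g u v, d < N := by
    intro d hd
    rw [← List.map_uncurry_zip_eq_zipWith, List.mem_map] at hd
    obtain ⟨p, hp, rfl⟩ := hd
    exact hg _ _ (forall_zip_lt hu hv p hp).1 (forall_zip_lt hu hv p hp).2
  have hOlen : (T1 (r .O)).length ≤ u.length * (2 * n) := by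
    simp only [hT1, Function.update_self]
    refine (length_outRev_map_le hglt hn).trans ?_
    rw [List.length_zipWith, huv, min_self]
  have hrev : (T1 (r .O)).reverse = encVec (List.zipWith g u v) := by
    simp only [hT1, Function.update_self]; exact reverse_outRev_map _
  refine (hl.seq hp).of_eq ?_ ?_
  · congr 1
    refine Regs.eq_of_on [r .L1, r .L2, r .O, r .DST] ?_ ?_
    · intro k hk
      simp only [List.mem_cons, List.not_mem_nil, or_false] at hk
      rcases hk with rfl | rfl | rfl | rfl
      · simp [hT1, hne]
      · simp [hT1, hne]
      · simp [hT1, hne, hO]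
      · rw [Function.update_self, Function.update_self, hrev]
        simp [hT1, hne]
    · intro k hk
      simp only [List.mem_cons, List.not_mem_nil, or_false, not_or] at hk
      obtain ⟨h₁, h₂, h₃, h₄⟩ := hk
      simp [hT1, h₁, h₂, h₃, h₄]
  · unfold vPassCost vBodyCost
    have hc : u.length * (n + 1) ≤ u.length * (n + 1) ^ 3 := Nat.mul_le_mul_left _ (succ_le_cube n)
    nlinarith [hOlen, hc]

/-! ### The four entrywise passes -/

/-- The modular-addition pass `DST := encVec (vaddMod N u v) ++ DST`. [folklore] -/
def vAddMod : Com (EReg ⊕ β) := vBinPass r (addModS r)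

/-- The modular-subtraction pass `DST := encVec (vsubMod N u v) ++ DST`. [folklore] -/
def vSubMod : Com (EReg ⊕ β) := vBinPass r (subModS r)

/-- The scalar pass `DST := encVec (vscaleMod N c u) ++ DST` (`c` in `C`). [folklore] -/
def vScaleMod : Com (EReg ⊕ β) := vUnPass r (scaleModS r)

/-- The negation pass `DST := encVec (u.map (negMod N)) ++ DST`. [folklore] -/
def vNegMod : Com (EReg ⊕ β) := vUnPass r (negModS r)

/-- Cost of the addition / subtraction / scalar / negation passes over `len` entries. [folklore] -/
def vArithCost (n len : ℕ) : ℕ := len * (1050 * (n + 1) ^ 3) + 5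

/-- Bounding a pass cost by a larger coefficient. [folklore] -/
theorem vPassCost_le {cS K n len : ℕ} (h : cS + 38 ≤ K) : vPassCost cS n len ≤ len * (K * (n + 1) ^ 3) + 5 :=
  Nat.add_le_add_right (Nat.mul_le_mul_left _ (Nat.mul_le_mul_right _ h)) _

/-- **The modular-addition pass.** (Knuth 1998, §4.3.1). [folklore] -/
theorem runs_vAddMod {N n : ℕ} (hn : (encodeNat N).length + 1 ≤ n) (T : Regs β) {u v : List ℕ}
    (huv : u.length = v.length) (hu : ∀ a ∈ u, a < N) (hv : ∀ b ∈ v, b < N)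
    (hL1 : T (r .L1) = encVec u) (hL2 : T (r .L2) = encVec v) (hMD : T (r .MD) = encodeNat N)
    (hA : T (r .A) = []) (hB : T (r .B) = []) (hD : T (r .D) = []) (hF : T (r .F) = [])
    (hW : T (r .W) = []) (hTT : T (r .TT) = []) (hO : T (r .O) = []) :
    Runs (vAddMod r) (base T)
      (base (Function.update (Function.update (Function.update T (r .L1) []) (r .L2) [])
        (r .DST) (encVec (vaddMod N u v) ++ T (r .DST)))) (vArithCost n u.length) :=
  (runs_vBinPass r (binSpec_addModS r hn (T (r .C))) (fun a b ha _ => Nat.mod_lt _ (by omega)) hn T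
    huv hu hv hL1 hL2 hMD rfl hA hB hD hF hW hTT hO).of_eq rfl
    (vPassCost_le (by simp only [addModS, NS.cost, NOp.cost, max_def]; norm_num))

/-- **The modular-subtraction pass.** (Knuth 1998, §4.3.1). [folklore] -/
theorem runs_vSubMod {N n : ℕ} (hn : (encodeNat N).length + 1 ≤ n) (T : Regs β) {u v : List ℕ}
    (huv : u.length = v.length) (hu : ∀ a ∈ u, a < N) (hv : ∀ b ∈ v, b < N)
    (hL1 : T (r .L1) = encVec u) (hL2 : T (r .L2) = encVec v) (hMD : T (r .MD) = encodeNat N)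
    (hA : T (r .A) = []) (hB : T (r .B) = []) (hD : T (r .D) = []) (hF : T (r .F) = [])
    (hW : T (r .W) = []) (hTT : T (r .TT) = []) (hO : T (r .O) = []) :
    Runs (vSubMod r) (base T)
      (base (Function.update (Function.update (Function.update T (r .L1) []) (r .L2) [])
        (r .DST) (encVec (vsubMod N u v) ++ T (r .DST)))) (vArithCost n u.length) :=
  (runs_vBinPass r (binSpec_subModS r hn (T (r .C))) (fun a b ha _ => Nat.mod_lt _ (by omega)) hn T
    huv hu hv hL1 hL2 hMD rfl hA hB hD hF hW hTT hO).of_eq rfl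
    (vPassCost_le (by simp only [subModS, NS.cost, NOp.cost, max_def]; norm_num))

/-- **The scalar pass.** (Knuth 1998, §4.3.1). [folklore] -/
theorem runs_vScaleMod {N n c : ℕ} (hn : (encodeNat N).length + 1 ≤ n) (hc : c < N) (T : Regs β)
    {u : List ℕ} (hu : ∀ a ∈ u, a < N) (hL1 : T (r .L1) = encVec u) (hMD : T (r .MD) = encodeNat N)
    (hC : T (r .C) = encodeNat c) (hA : T (r .A) = []) (hB : T (r .B) = []) (hD : T (r .D) = [])
    (hF : T (r .F) = []) (hW : T (r .W) = []) (hTT : T (r .TT) = []) (hO : T (r .O) = []) :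
    Runs (vScaleMod r) (base T)
      (base (Function.update (Function.update T (r .L1) []) (r .DST) (encVec (vscaleMod N c u) ++ T (r .DST))))
      (vArithCost n u.length) :=
  (runs_vUnPass r (unSpec_scaleModS r hn hc) (fun a _ => Nat.mod_lt _ (by omega)) hn T hu hL1 hMD hC
    hA hB hD hF hW hTT hO).of_eq rfl
    (vPassCost_le (by simp only [scaleModS, NS.cost, NOp.cost]; norm_num))

/-- **The negation pass.** [folklore] -/
theorem runs_vNegMod {N n : ℕ} (hn : (encodeNat N).length + 1 ≤ n) (T : Regs β) {u : List ℕ}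
    (hu : ∀ a ∈ u, a < N) (hL1 : T (r .L1) = encVec u) (hMD : T (r .MD) = encodeNat N)
    (hA : T (r .A) = []) (hB : T (r .B) = []) (hD : T (r .D) = []) (hF : T (r .F) = [])
    (hW : T (r .W) = []) (hTT : T (r .TT) = []) (hO : T (r .O) = []) :
    Runs (vNegMod r) (base T)
      (base (Function.update (Function.update T (r .L1) []) (r .DST) (encVec (u.map (negMod N)) ++ T (r .DST))))
      (vArithCost n u.length) :=
  (runs_vUnPass r (unSpec_negModS r hn (T (r .C))) (fun a _ => negMod_lt (by omega) a) hn T hu hL1 hMD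
    rfl hA hB hD hF hW hTT hO).of_eq rfl
    (vPassCost_le (by simp only [negModS, NS.cost, NOp.cost, max_def]; norm_num))

/-! ### The negacyclic shift pass -/

/-- The split point of the shift: the first `shiftSplit L e` entries of the input are moved
last. [folklore] -/
def shiftSplit (L e : ℕ) : ℕ := if e < L then L - e else 2 * L - e

/-- The setup script of the shift: `S := shiftSplit L e`, `G := flag (L ≤ e)` (flag `F`).
[folklore] -/
def shiftSetupS : NS β :=
  .seq (.op (.cmp (r .F) (r .E) (r .LEN)))
    (.ite (r .F)
      (.seq (.op (.sub (r .S) (r .E) (r .LEN))) (.seq (.op (.sub (r .S) (r .LEN) (r .S))) (.op (.push (r .G) true))))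
      (.op (.sub (r .S) (r .LEN) (r .E))))

/-- Symbolic execution of the setup script. [folklore] -/
theorem shiftSetupS_spec (T : Regs β) {L e n : ℕ} (hE : T (r .E) = encodeNat e) (hLEN : T (r .LEN) = encodeNat L)
    (hF : T (r .F) = []) (hG : T (r .G) = []) (hS : T (r .S) = []) (he : e < 2 * L)
    (hn : (encodeNat L).length + 1 ≤ n) :
    (shiftSetupS r).ok T n ∧ (shiftSetupS r).eval T =
      Function.update (Function.update T (r .S) (encodeNat (shiftSplit L e))) (r .G) (flag (decide (L ≤ e))) := by
  have hne : ∀ {i j : VReg}, i ≠ j → r i ≠ r j := fun h => r.injective.ne h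
  have hle : (encodeNat e).length ≤ n := by
    have := Brick.length_encodeNat_mono (Nat.le_of_lt_succ (Nat.lt_succ_of_lt he))
    have h2 : (encodeNat (2 * L)).length ≤ (encodeNat L).length + 1 := by
      rcases Nat.eq_zero_or_pos L with rfl | hL
      · simp
      · rw [TM2Pass.length_encodeNat_eq_size, TM2Pass.length_encodeNat_eq_size,
          show 2 * L = L <<< 1 by rw [Nat.shiftLeft_eq]; ring, Nat.size_shiftLeft (by omega)]
    omega
  have hlL : (encodeNat L).length ≤ n := by omega
  have hFT : Function.update T (r .F) [] = T := Function.update_eq_self_iff.2 hF.symm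
  by_cases hc : L ≤ e
  · have hs : shiftSplit L e = L - (e - L) := by unfold shiftSplit; rw [if_neg (by omega)]; omega
    have hl1 : (encodeNat (e - L)).length ≤ n := (Brick.length_encodeNat_mono (Nat.sub_le e L)).trans hle
    have hl2 : (encodeNat (e - L)).length ≤ n + 1 := hl1.trans (Nat.le_succ n)
    refine ⟨by simp [shiftSetupS, hE, hLEN, hF, hS, hne, hle, hlL, hc, hl1, hl2, (by omega : e - L ≤ L)], ?_⟩
    have hev : (shiftSetupS r).eval T = Function.update (Function.update (Function.update (Function.update T
        (r .F) []) (r .S) (encodeNat (e - L))) (r .S) (encodeNat (L - (e - L)))) (r .G) [true] := by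
      simp [shiftSetupS, hE, hLEN, hne, hc, hG]
    rw [hev, hFT, Function.update_idem, hs]
    simp [hc]
  · have hs : shiftSplit L e = L - e := by unfold shiftSplit; rw [if_pos (by omega)]
    refine ⟨by simp [shiftSetupS, hE, hLEN, hF, hS, hle, hlL, hc, (by omega : e ≤ L)], ?_⟩
    have hev : (shiftSetupS r).eval T = Function.update (Function.update T (r .F) []) (r .S) (encodeNat (L - e)) := by
      simp [shiftSetupS, hE, hLEN, hc]
    rw [hev, hFT, hs]
    simp only [hc, decide_false, flag_false]
    symm
    exact Function.update_eq_self_iff.2 (by rw [Function.update_of_ne (hne (by decide)), hG])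

/-- The invariant of the shift rounds: modulus in place, scratch clean, the sign flag `G` holds
`flag b`. [folklore] -/
def ShiftInv (N : ℕ) (b : Bool) (T : Regs β) : Prop :=
  T (r .MD) = encodeNat N ∧ T (r .A) = [] ∧ T (r .B) = [] ∧ T (r .D) = [] ∧ T (r .F) = [] ∧
    T (r .W) = [] ∧ T (r .TT) = [] ∧ T (r .G) = flag b

/-- The shift invariant is a frame invariant. [folklore] -/
theorem frameInv_shiftInv (N : ℕ) (b : Bool) : FrameInv r (ShiftInv r N b) := by
  have hne : ∀ {i j : VReg}, i ≠ j → r i ≠ r j := fun h => r.injective.ne h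
  rintro T x w hx ⟨h1, h2, h3, h4, h5, h6, h7, h8⟩
  rcases hx with rfl | rfl | rfl | rfl <;> exact ⟨by simp [hne, h1], by simp [hne, h2], by simp [hne, h3],
    by simp [hne, h4], by simp [hne, h5], by simp [hne, h6], by simp [hne, h7], by simp [hne, h8]⟩

/-- Round of the first phase: negate iff the flag is set. [folklore] -/
def shiftBodyB : Com (EReg ⊕ β) := ifNonempty (vr r .G) (vUnBody r (negModS r)) (vUnBody r (moveS r))

/-- Round of the second phase: negate iff the flag is clear. [folklore] -/
def shiftBodyC : Com (EReg ⊕ β) := ifNonempty (vr r .G) (vUnBody r (moveS r)) (vUnBody r (negModS r))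

/-- Cost of a shift round. [folklore] -/
def shiftRoundCost (n : ℕ) : ℕ := vBodyCost 132 n + 3

/-- The first-phase round is a unary round computing `negMod N` or the identity. [folklore] -/
theorem unRound_shiftBodyB {N n : ℕ} (hn : (encodeNat N).length + 1 ≤ n) (b : Bool) :
    UnRound r (shiftBodyB r) (ShiftInv r N b) N (fun a => if b then negMod N a else a) (shiftRoundCost n) := by
  intro T a u ⟨hMD, hA, hB, hD, hF, hW, hTT, hG⟩ hL1 ha
  have hN : 0 < N := by omega
  cases b
  · have h := runs_vUnBody r (unSpec_moveS r hn (T (r .C))) (fun a h => h) hn T hL1 hMD rfl hA hB hD hF hW hTT ha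
    refine (runs_ifNonempty_nil _ (by simpa using hG) h).of_eq (by simp) ?_
    unfold shiftRoundCost vBodyCost; exact Nat.add_le_add (Nat.mul_le_mul_right _ (by norm_num [moveS])) (by norm_num)
  · have h := runs_vUnBody r (unSpec_negModS r hn (T (r .C))) (fun a _ => negMod_lt hN a) hn T hL1 hMD rfl hA hB
      hD hF hW hTT ha
    refine (runs_ifNonempty_cons (b := true) (rest := []) _ (by simpa using hG) h).of_eq (by simp) ?_
    unfold shiftRoundCost vBodyCost; simp only [negModS, NS.cost, NOp.cost, max_def]; norm_num

/-- The second-phase round is a unary round computing the identity or `negMod N`. [folklore] -/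
theorem unRound_shiftBodyC {N n : ℕ} (hn : (encodeNat N).length + 1 ≤ n) (b : Bool) :
    UnRound r (shiftBodyC r) (ShiftInv r N b) N (fun a => if b then a else negMod N a) (shiftRoundCost n) := by
  intro T a u ⟨hMD, hA, hB, hD, hF, hW, hTT, hG⟩ hL1 ha
  have hN : 0 < N := by omega
  cases b
  · have h := runs_vUnBody r (unSpec_negModS r hn (T (r .C))) (fun a _ => negMod_lt hN a) hn T hL1 hMD rfl hA hB
      hD hF hW hTT ha
    refine (runs_ifNonempty_nil _ (by simpa using hG) h).of_eq (by simp) ?_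
    unfold shiftRoundCost vBodyCost; simp only [negModS, NS.cost, NOp.cost, max_def]; norm_num
  · have h := runs_vUnBody r (unSpec_moveS r hn (T (r .C))) (fun a h => h) hn T hL1 hMD rfl hA hB hD hF hW hTT ha
    refine (runs_ifNonempty_cons (b := true) (rest := []) _ (by simpa using hG) h).of_eq (by simp) ?_
    unfold shiftRoundCost vBodyCost; exact Nat.add_le_add (Nat.mul_le_mul_right _ (by norm_num [moveS])) (by norm_num)

/-- **The negacyclic shift pass** `vNegShift`: with the block `u` of length `L` in `L1`, the
shift `e < 2L` in `E` and `L` in `LEN`, put `encVec (negShift N L e u)` — the coefficients of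
`x^e · u(x)` in `(ℤ/N)[x]/(x^L+1)` — on top of `DST`: compute the split point and the sign flag,
move the first `shiftSplit L e` entries (negated iff `L ≤ e`) and pour them, then the rest
(negated iff `e < L`) and pour them on top. [von zur Gathen–Gerhard 2013, §8.3] [folklore] -/
def vNegShift : Com (EReg ⊕ β) :=
  (shiftSetupS r).com ;; (nToUnary (r .U) (r .S) ;; (countLoop (vr r .U) (shiftBodyB r) ;;
    (pour (vr r .O) (vr r .DST) ;; (streamLoop (vr r .L1) (vr r .W) (shiftBodyC r) ;;
    (pour (vr r .O) (vr r .DST) ;; (clear (vr r .S) ;; clear (vr r .G)))))))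

/-- Cost of the shift pass on a block of length `L` at size bound `n`. [folklore] -/
def vShiftCost (n L : ℕ) : ℕ := L * (400 * (n + 1) ^ 3) + 250 * (n + 1) ^ 3

/-- The split point is at most the block length. [folklore] -/
theorem shiftSplit_le (L e : ℕ) : shiftSplit L e ≤ L := by
  unfold shiftSplit; split_ifs <;> omega

/-- The two phases produce `negShift`. [folklore] -/
theorem negShift_eq_phases (N L e : ℕ) (u : List ℕ) :
    negShift N L e u =
      (u.drop (shiftSplit L e)).map (fun a => if decide (L ≤ e) then a else negMod N a) ++
        (u.take (shiftSplit L e)).map (fun a => if decide (L ≤ e) then negMod N a else a) := by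
  unfold negShift shiftSplit
  by_cases h : e < L
  · simp [h, Nat.not_le.2 h]
  · simp [h, Nat.not_lt.1 h]

/-- **The negacyclic shift pass.** From `L1 = encVec u` (`|u| = L`, entries `< N`),
`E = encodeNat e` (`e < 2L`), `LEN = encodeNat L`, `MD = encodeNat N` and clean scratch,
`vNegShift` empties `L1` and puts `encVec (negShift N L e u)` on top of `DST`, all scratch clean
again, within `vShiftCost n L` (for `n ≥ |N| + 1` and `n ≥ |L| + 1`). [von zur Gathen–Gerhard
2013, §8.3] [folklore] -/
theorem runs_vNegShift {N n L e : ℕ} (hn : (encodeNat N).length + 1 ≤ n)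
    (hLn : (encodeNat L).length + 1 ≤ n) (he : e < 2 * L) (T : Regs β) {u : List ℕ}
    (hu : ∀ a ∈ u, a < N) (huL : u.length = L) (hL1 : T (r .L1) = encVec u)
    (hMD : T (r .MD) = encodeNat N) (hE : T (r .E) = encodeNat e) (hLEN : T (r .LEN) = encodeNat L)
    (hA : T (r .A) = []) (hB : T (r .B) = []) (hD : T (r .D) = []) (hF : T (r .F) = [])
    (hG : T (r .G) = []) (hW : T (r .W) = []) (hTT : T (r .TT) = []) (hO : T (r .O) = [])
    (hS : T (r .S) = []) (hU : T (r .U) = []) :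
    Runs (vNegShift r) (base T)
      (base (Function.update (Function.update T (r .L1) []) (r .DST) (encVec (negShift N L e u) ++ T (r .DST))))
      (vShiftCost n L) := by
  have hne : ∀ {i j : VReg}, i ≠ j → r i ≠ r j := fun h => r.injective.ne h
  set sp := shiftSplit L e with hsp
  set b := decide (L ≤ e) with hb
  have hspL : sp ≤ L := shiftSplit_le L e
  set g₁ : ℕ → ℕ := fun a => if b then negMod N a else a with hg₁d
  set g₂ : ℕ → ℕ := fun a => if b then a else negMod N a with hg₂d
  have hfin : encVec ((u.drop sp).map g₂) ++ (encVec ((u.take sp).map g₁) ++ T (r .DST)) =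
      encVec (negShift N L e u) ++ T (r .DST) := by
    rw [negShift_eq_phases, encVec_append, List.append_assoc]
  have hg₁ : ∀ a, a < N → g₁ a < N := fun a ha => by
    simp only [hg₁d]; split_ifs; exacts [negMod_lt (by omega) a, ha]
  have hg₂ : ∀ a, a < N → g₂ a < N := fun a ha => by
    simp only [hg₂d]; split_ifs; exacts [ha, negMod_lt (by omega) a]
  have hsplen : (encodeNat sp).length ≤ n - 1 := (Brick.length_encodeNat_mono hspL).trans (by omega)
  -- cost units
  set c := (n + 1) ^ 3 with hc3
  have hc : n + 1 ≤ c := succ_le_cube n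
  have hLc : L * (n + 1) ≤ L * c := Nat.mul_le_mul_left _ hc
  -- 1. setup
  have hsu := shiftSetupS_spec r T hE hLEN hF hG hS he hLn
  set T1 := Function.update (Function.update T (r .S) (encodeNat sp)) (r .G) (flag b) with hT1
  have h1 : Runs (shiftSetupS r).com (base T) (base T1) (201 * c) :=
    NS.runs_of_eq _ _ hsu.1 hsu.2 (by simp only [shiftSetupS, NS.cost, NOp.cost, max_def, hc3]; norm_num)
  -- 2. unary counter
  set T2 := Function.update T1 (r .U) (List.replicate sp true) with hT2
  have h2 : Runs (nToUnary (r .U) (r .S)) (base T1) (base T2) (16 * (L * c) + 26 * c) := by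
    refine (runs_nToUnary (r .U) (r .S) T1 (by simp [hT1, hne, hU])).of_eq (by simp [hT2, hT1, hne]) ?_
    have h1 : (T1 (r .S)).length ≤ n - 1 := by simp [hT1, hne, hsplen]
    have h2 : bitsToNat (T1 (r .S)) = sp := by simp [hT1, hne]
    rw [h2]
    have h3 : (T1 (r .S)).length * (16 * sp + 21) ≤ (n - 1) * (16 * L + 21) := Nat.mul_le_mul h1 (by omega)
    have h4 : (n - 1) * (16 * L + 21) ≤ 16 * (L * (n + 1)) + 21 * (n + 1) := by nlinarith [Nat.sub_le n 1]
    omega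
  -- 3. first phase
  have hI2 : ShiftInv r N b T2 :=
    ⟨by simp [hT2, hT1, hne, hMD], by simp [hT2, hT1, hne, hA], by simp [hT2, hT1, hne, hB],
      by simp [hT2, hT1, hne, hD], by simp [hT2, hT1, hne, hF], by simp [hT2, hT1, hne, hW],
      by simp [hT2, hT1, hne, hTT], by simp [hT2, hT1, hne]⟩
  have htake : ∀ a ∈ u.take sp, a < N := fun a ha => hu a (List.mem_of_mem_take ha)
  have hdrop : ∀ a ∈ u.drop sp, a < N := fun a ha => hu a (List.mem_of_mem_drop ha)
  have htlen : (u.take sp).length = sp := by rw [List.length_take, huL, min_eq_left hspL]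
  set T3 := Function.update (Function.update (Function.update T2 (r .L1) (encVec (u.drop sp))) (r .U) [])
    (r .O) (outRev (((u.take sp).map g₁).map encodeNat)) with hT3
  have h3 : Runs (countLoop (vr r .U) (shiftBodyB r)) (base T2) (base T3) (168 * (L * c) + c) := by
    have h := runs_countLoop_un r (frameInv_shiftInv r N b) (unRound_shiftBodyB r hn b) T2 (u₁ := u.take sp)
      (u₂ := u.drop sp) htake hI2 (by simp [hT2, hT1, hne, hL1, List.take_append_drop]) (by simp [hT2, htlen])
    rw [htlen] at h
    refine h.of_eq (by simp [hT3, hT2, hT1, hne, hO, hg₁d]) ?_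
    unfold shiftRoundCost vBodyCost
    rw [← hc3]
    have hL1 : L ≤ L * c := Nat.le_mul_of_pos_right _ (by omega)
    have : sp * ((132 + 31) * c + 3 + 2) ≤ 168 * (L * c) := by
      nlinarith [Nat.mul_le_mul_right ((132 + 31) * c + 3 + 2) hspL, hL1]
    omega
  -- 4. pour
  set T4 := Function.update (Function.update T3 (r .O) []) (r .DST) (encVec ((u.take sp).map g₁) ++ T (r .DST)) with hT4
  have hO3 : T3 (r .O) = outRev (((u.take sp).map g₁).map encodeNat) := by simp [hT3]
  have hO3len : (T3 (r .O)).length ≤ L * (2 * n) := by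
    rw [hO3]
    refine (length_outRev_map_le (fun d hd => ?_) hn).trans ?_
    · rw [List.mem_map] at hd; obtain ⟨a, ha, rfl⟩ := hd; exact hg₁ a (htake a ha)
    · rw [List.length_map, htlen]; exact Nat.mul_le_mul_right _ hspL
  have h4 : Runs (pour (vr r .O) (vr r .DST)) (base T3) (base T4) (6 * (L * c) + c) := by
    refine (runs_opour (a := r .O) (b := r .DST) (hne (by decide)) T3).of_eq ?_ ?_
    · simp only [hT4, hO3, reverse_outRev_map]
      congr 2
      simp [hT3, hT2, hT1, hne]
    · have : L * (2 * n) ≤ 2 * (L * (n + 1)) := by nlinarith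
      omega
  -- 5. second phase
  have hI4 : ShiftInv r N b T4 :=
    ⟨by simp [hT4, hT3, hT2, hT1, hne, hMD], by simp [hT4, hT3, hT2, hT1, hne, hA],
      by simp [hT4, hT3, hT2, hT1, hne, hB], by simp [hT4, hT3, hT2, hT1, hne, hD],
      by simp [hT4, hT3, hT2, hT1, hne, hF], by simp [hT4, hT3, hT2, hT1, hne, hW],
      by simp [hT4, hT3, hT2, hT1, hne, hTT], by simp [hT4, hT3, hT2, hT1, hne]⟩
  set T5 := Function.update (Function.update T4 (r .L1) []) (r .O) (outRev (((u.drop sp).map g₂).map encodeNat)) with hT5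
  have h5 : Runs (streamLoop (vr r .L1) (vr r .W) (shiftBodyC r)) (base T4) (base T5) (172 * (L * c) + 4 * c) := by
    have h := runs_streamLoop_un r (frameInv_shiftInv r N b) (unRound_shiftBodyC r hn b) T4 hdrop hI4
      (by simp [hT4, hT3, hne]) (by simp [hT4, hT3, hT2, hT1, hne, hW])
    rw [List.length_drop, huL] at h
    refine h.of_eq (by simp [hT5, hT4, hne, hg₂d]) ?_
    unfold shiftRoundCost vBodyCost
    rw [← hc3]
    have hL1 : L ≤ L * c := Nat.le_mul_of_pos_right _ (by omega)
    have : (L - sp) * ((132 + 31) * c + 3 + 6) ≤ 172 * (L * c) := by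
      nlinarith [Nat.mul_le_mul_right ((132 + 31) * c + 3 + 6) (Nat.sub_le L sp), hL1]
    omega
  -- 6. pour
  set T6 := Function.update (Function.update T5 (r .O) []) (r .DST) (encVec (negShift N L e u) ++ T (r .DST)) with hT6
  have hO5 : T5 (r .O) = outRev (((u.drop sp).map g₂).map encodeNat) := by simp [hT5]
  have hO5len : (T5 (r .O)).length ≤ L * (2 * n) := by
    rw [hO5]
    refine (length_outRev_map_le (fun d hd => ?_) hn).trans ?_
    · rw [List.mem_map] at hd; obtain ⟨a, ha, rfl⟩ := hd; exact hg₂ a (hdrop a ha)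
    · rw [List.length_map, List.length_drop, huL]; exact Nat.mul_le_mul_right _ (Nat.sub_le L sp)
  have h6 : Runs (pour (vr r .O) (vr r .DST)) (base T5) (base T6) (6 * (L * c) + c) := by
    refine (runs_opour (a := r .O) (b := r .DST) (hne (by decide)) T5).of_eq ?_ ?_
    · simp only [hT6, hO5, reverse_outRev_map, ← hfin]
      congr 2
      simp [hT5, hT4, hne]
    · have : L * (2 * n) ≤ 2 * (L * (n + 1)) := by nlinarith
      omega
  -- 7. clean up
  set T7 := Function.update T6 (r .S) [] with hT7
  have h7 : Runs (clear (vr r .S)) (base T6) (base T7) (3 * c) := by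
    refine (runs_clear (vr r .S) (base T6)).of_eq (by simp [hT7]) ?_
    have : (T6 (r .S)).length ≤ n - 1 := by simp [hT6, hT5, hT4, hT3, hT2, hT1, hne, hsplen]
    change 2 * (T6 (r .S)).length + 1 ≤ 3 * c
    omega
  set T8 := Function.update T7 (r .G) [] with hT8
  have h8 : Runs (clear (vr r .G)) (base T7) (base T8) (3 * c) := by
    refine (runs_clear (vr r .G) (base T7)).of_eq (by simp [hT8]) ?_
    have hG7 : T7 (r .G) = flag b := by simp [hT7, hT6, hT5, hT4, hT3, hT2, hT1, hne]
    have := length_flag_le b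
    change 2 * (T7 (r .G)).length + 1 ≤ 3 * c
    rw [hG7]; omega
  refine (h1.seq (h2.seq (h3.seq (h4.seq (h5.seq (h6.seq (h7.seq h8))))))).of_eq ?_ ?_
  · congr 1
    refine Regs.eq_of_on [r .L1, r .DST, r .O, r .U, r .S, r .G] ?_ ?_
    · intro k hk
      simp only [List.mem_cons, List.not_mem_nil, or_false] at hk
      rcases hk with rfl | rfl | rfl | rfl | rfl | rfl
      · simp [hT8, hT7, hT6, hT5, hne]
      · simp [hT8, hT7, hT6, hne]
      · simp [hT8, hT7, hT6, hne, hO]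
      · simp [hT8, hT7, hT6, hT5, hT4, hT3, hne, hU]
      · simp [hT8, hT7, hne, hS]
      · simp [hT8, hG]
    · intro k hk
      simp only [List.mem_cons, List.not_mem_nil, or_false, not_or] at hk
      obtain ⟨h₁, h₂, h₃, h₄, h₅, h₆⟩ := hk
      simp [hT8, hT7, hT6, hT5, hT4, hT3, hT2, hT1, h₁, h₂, h₃, h₄, h₅, h₆]
  · have : vShiftCost n L = 400 * (L * c) + 250 * c := by unfold vShiftCost; rw [← hc3]; ring
    rw [this]
    omega

end Com

end Literature.Computability.Complexity
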